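import Literature.RingTheory.Flat.UniversallyInjective
import Mathlib.RingTheory.Flat.Basic
import Mathlib.LinearAlgebra.TensorProduct.RightExactness
import Mathlib.LinearAlgebra.TensorProduct.Pi
import HarnessLib

/-!
# Universally injective maps: the tensor characterisation and flatness of the cokernel

Topic: `Literature/RingTheory/Flat`. Complements to `UniversallyInjective.lean` (where universal
injectivity of `f : M → N` is DEFINED by the equational criterion of Stacks, Tag 058K (3), and
shown to imply injectivity of every `f ⊗ Q`):

* `isUniversallyInjective_of_forall_rTensor_injective` — **Stacks, Tag 058K, (1) ⇒ (3)**: if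
  `f ⊗ Q` is injective for every `R`-module `Q` in the universe of `R` then `f` is universally
  injective (take `Q = R^ι/A R^κ` for the matrix `A = (aᵢⱼ)` of the relations); with
  `IsUniversallyInjective.rTensor_injective` this shows that the definition is the one of
  Stacks, Tag 058I;
* `IsUniversallyInjective.flat_of_flat` — the source of a universally injective map into a
  flat module is flat, and
* `IsUniversallyInjective.flat_cokernel` — **Stacks, Tag 058P**: its cokernel is flat
  ("`0 → M₁ → M₂ → M₃ → 0` universally exact and `M₂` flat ⇒ `M₁, M₃` flat"), by the usual
  chase in the tensored ladder.

## References

* The Stacks Project, Tags 058K, 058P (Algebra, §10.82). [StacksProject]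
-/

namespace Literature.RingTheory.Flat

universe u

open TensorProduct LinearMap Function

variable {R : Type u} [CommRing R]
variable {M : Type*} [AddCommGroup M] [Module R M]
variable {N : Type*} [AddCommGroup N] [Module R N]

/-! ## Tag 058K, (1) ⇒ (3) -/

/-- **Stacks, Tag 058K, (1) ⇒ (3).** If `f ⊗ Q : M ⊗ Q → N ⊗ Q` is injective for every
`R`-module `Q` (in the universe of `R`), then `f` is universally injective in the sense of the
equational criterion. Proof as printed: for relations `f(xᵢ) = ∑ⱼ aᵢⱼ yⱼ` let `Q = R^ι/A(R^κ)`
with `A(dⱼ) = ∑ᵢ aᵢⱼ eᵢ`; the tensor `∑ᵢ xᵢ ⊗ ēᵢ ∈ M ⊗ Q` maps to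
`∑ⱼ yⱼ ⊗ (A dⱼ)‾ = 0`, so it vanishes, i.e. `(xᵢ)ᵢ` lies in the image of
`A_M : M^κ → M^ι` (right exactness of `M ⊗ -` and `M ⊗ R^ι = M^ι`).
[cite: StacksProject, Tag 058K] -/
theorem isUniversallyInjective_of_forall_rTensor_injective (f : M →ₗ[R] N)
    (h : ∀ (Q : Type u) [AddCommGroup Q] [Module R Q], Function.Injective (f.rTensor Q)) :
    IsUniversallyInjective f := by
  classical
  intro ι κ _ _ x y a hrel
  -- the matrix of the relations as a map `A : R^κ → R^ι`, and its cokernel `Q`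
  let A : (κ → R) →ₗ[R] (ι → R) := Fintype.linearCombination R fun j i => a i j
  let Q := (ι → R) ⧸ LinearMap.range A
  have hAQ : Exact A (LinearMap.range A).mkQ := LinearMap.exact_map_mkQ_range A
  -- `∑ xᵢ ⊗ ēᵢ ↦ ∑ f(xᵢ) ⊗ ēᵢ = ∑ⱼ yⱼ ⊗ (A dⱼ)‾ = 0`
  let e : ι → Q := fun i => (LinearMap.range A).mkQ (Pi.single i 1)
  have hcol : ∀ j, ∑ i, a i j • e i = 0 := fun j => by
    have hAj : A (Pi.single j 1) = fun i => a i j := by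
      simp only [A, Fintype.linearCombination_apply_single, one_smul]
    have : (LinearMap.range A).mkQ (A (Pi.single j 1)) = 0 :=
      (Submodule.Quotient.mk_eq_zero _).mpr (LinearMap.mem_range_self A _)
    rw [hAj] at this
    rw [← this, show (fun i => a i j) = ∑ i, a i j • (Pi.single i 1 : ι → R) by
      funext i'
      simp [Finset.sum_apply, Pi.single_apply], map_sum]
    simp_rw [map_smul]
    rfl
  have hzero : f.rTensor Q (∑ i, x i ⊗ₜ[R] e i) = 0 := by
    simp only [map_sum, LinearMap.rTensor_tmul, hrel]
    calc ∑ i, (∑ j, a i j • y j) ⊗ₜ[R] e i = ∑ j, y j ⊗ₜ[R] ∑ i, a i j • e i := by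
          simp_rw [TensorProduct.sum_tmul, TensorProduct.tmul_sum, TensorProduct.smul_tmul]
          exact Finset.sum_comm
      _ = 0 := by simp [hcol]
  have hvan : ∑ i, x i ⊗ₜ[R] e i = 0 := (injective_iff_map_eq_zero _).mp (h Q) _ hzero
  -- right exactness: `t = ∑ xᵢ ⊗ eᵢ ∈ M ⊗ R^ι` lies in the image of `M ⊗ R^κ`
  have hexact := lTensor_exact M hAQ (Submodule.mkQ_surjective _)
  have ht0 : (LinearMap.range A).mkQ.lTensor M (∑ i, x i ⊗ₜ[R] (Pi.single i 1 : ι → R)) = 0 := by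
    simp only [map_sum, LinearMap.lTensor_tmul]
    exact hvan
  obtain ⟨w, hw⟩ := (hexact _).mp ht0
  -- transport along `M ⊗ R^ι ≃ M^ι`
  let AM' : (κ → M) →ₗ[R] (ι → M) :=
    { toFun := fun z i => ∑ j, a i j • z j
      map_add' := fun z z' => by
        funext i
        simp [smul_add, Finset.sum_add_distrib]
      map_smul' := fun c z => by
        funext i
        simp [Finset.smul_sum, smul_comm c] }
  have hsq : (TensorProduct.piScalarRight R R M ι).toLinearMap ∘ₗ A.lTensor M =
      AM' ∘ₗ (TensorProduct.piScalarRight R R M κ).toLinearMap := by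
    apply TensorProduct.ext'
    intro m c
    funext i
    simp only [LinearMap.comp_apply, LinearMap.lTensor_tmul, LinearEquiv.coe_coe,
      TensorProduct.piScalarRight_apply, TensorProduct.piScalarRightHom_tmul, AM', LinearMap.coe_mk,
      AddHom.coe_mk, A, Fintype.linearCombination_apply, Finset.sum_apply, Pi.smul_apply,
      smul_eq_mul, Finset.sum_smul, smul_smul]
    refine Finset.sum_congr rfl fun j _ => ?_
    rw [mul_comm]
  have hx : (fun i => x i) = TensorProduct.piScalarRight R R M ι (∑ i, x i ⊗ₜ[R] (Pi.single i 1 : ι → R)) := by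
    funext i
    simp only [map_sum, TensorProduct.piScalarRight_apply, TensorProduct.piScalarRightHom_tmul,
      Finset.sum_apply, Pi.single_apply, ite_smul, one_smul, zero_smul,
      Finset.sum_ite_eq, Finset.mem_univ, if_true]
  refine ⟨TensorProduct.piScalarRight R R M κ w, fun i => ?_⟩
  have := congrFun hx i
  rw [← hw] at this
  rw [this]
  change ((TensorProduct.piScalarRight R R M ι).toLinearMap ∘ₗ A.lTensor M) w i = _
  rw [hsq]
  rfl

/-! ## Tag 058P: flatness of the source and of the cokernel -/

variable {f : M →ₗ[R] N}

/-- The source of a universally injective map into a flat module is flat (Stacks, Tag 058P,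
first half). [cite: StacksProject, Tag 058P] -/
theorem IsUniversallyInjective.flat_of_flat (hf : IsUniversallyInjective f) [Module.Flat R N] :
    Module.Flat R M := by
  rw [Module.Flat.iff_rTensor_preserves_injective_linearMap]
  intro N₀ N₀' _ _ _ _ i hi
  have hnat : (f.lTensor N₀') ∘ₗ (i.rTensor M) = (i.rTensor N) ∘ₗ (f.lTensor N₀) :=
    TensorProduct.ext' fun k m => rfl
  have h1 : Function.Injective ((f.lTensor N₀') ∘ₗ (i.rTensor M)) := by
    rw [hnat, LinearMap.coe_comp]
    exact (Module.Flat.rTensor_preserves_injective_linearMap i hi).comp (hf.lTensor_injective N₀)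
  rw [LinearMap.coe_comp] at h1
  exact Function.Injective.of_comp h1

/-- **Stacks, Tag 058P: the cokernel of a universally injective map into a flat module is
flat** ("`0 → M₁ → M₂ → M₃ → 0` universally exact, `M₂` flat ⇒ `M₃` flat"). Chase, for an
injective `i : K → P`: for `c ∈ K ⊗ M₃` vanishing in `P ⊗ M₃`, lift `c` to `b ∈ K ⊗ N`; its
image in `P ⊗ N` comes from `a ∈ P ⊗ M`, whose image in `(P/K) ⊗ M` is killed by the injective
`(P/K) ⊗ f`, so `a` comes from `a' ∈ K ⊗ M`; then `b - (K ⊗ f) a'` vanishes in `P ⊗ N`, hence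
(as `N` is flat) `b = (K ⊗ f) a'` and `c = 0`. [cite: StacksProject, Tag 058P] -/
theorem IsUniversallyInjective.flat_cokernel (hf : IsUniversallyInjective f) [Module.Flat R N] :
    Module.Flat R (N ⧸ LinearMap.range f) := by
  rw [Module.Flat.iff_rTensor_preserves_injective_linearMap]
  intro K P _ _ _ _ i hi
  set g := (LinearMap.range f).mkQ with hgdef
  have hfg : Function.Exact f g := LinearMap.exact_map_mkQ_range f
  have hg : Function.Surjective g := Submodule.mkQ_surjective _
  rw [injective_iff_map_eq_zero]
  intro c hc
  -- lift `c ∈ K ⊗ M₃` to `b ∈ K ⊗ N`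
  obtain ⟨b, rfl⟩ := LinearMap.lTensor_surjective K hg c
  have hnat₁ : (i.rTensor (N ⧸ LinearMap.range f)) ∘ₗ (g.lTensor K) =
      (g.lTensor P) ∘ₗ (i.rTensor N) := TensorProduct.ext' fun k n => rfl
  have hb : (g.lTensor P) ((i.rTensor N) b) = 0 := by
    rw [← LinearMap.comp_apply, ← hnat₁, LinearMap.comp_apply, hc]
  -- exactness of `P ⊗ M → P ⊗ N → P ⊗ M₃`
  obtain ⟨a, ha⟩ := ((lTensor_exact P hfg hg) _).mp hb
  -- push to `P / i(K)`
  set q := (LinearMap.range i).mkQ with hqdef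
  have hiq : Function.Exact i q := LinearMap.exact_map_mkQ_range i
  have hnat₂ : (q.rTensor N) ∘ₗ (f.lTensor P) = (f.lTensor (P ⧸ LinearMap.range i)) ∘ₗ (q.rTensor M) :=
    TensorProduct.ext' fun p m => rfl
  have hKexactN : Function.Exact (i.rTensor N) (q.rTensor N) :=
    rTensor_exact N hiq (Submodule.mkQ_surjective _)
  have h3 : (f.lTensor (P ⧸ LinearMap.range i)) ((q.rTensor M) a) = 0 := by
    rw [← LinearMap.comp_apply, ← hnat₂, LinearMap.comp_apply, ha]
    exact (hKexactN _).mpr ⟨b, rfl⟩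
  have h4 : (q.rTensor M) a = 0 :=
    (injective_iff_map_eq_zero _).mp (hf.lTensor_injective (P ⧸ LinearMap.range i)) _ h3
  -- exactness of `K ⊗ M → P ⊗ M → (P/K) ⊗ M`
  obtain ⟨a', rfl⟩ := ((rTensor_exact M hiq (Submodule.mkQ_surjective _)) _).mp h4
  -- `b - (K ⊗ f) a'` vanishes in `P ⊗ N`, hence is zero as `N` is flat
  have hnat₃ : (f.lTensor P) ∘ₗ (i.rTensor M) = (i.rTensor N) ∘ₗ (f.lTensor K) :=
    TensorProduct.ext' fun k m => rfl
  have h5 : (i.rTensor N) (b - (f.lTensor K) a') = 0 := by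
    rw [map_sub, sub_eq_zero, ← ha, ← LinearMap.comp_apply, hnat₃, LinearMap.comp_apply]
  have hinjN : Function.Injective (i.rTensor N) := Module.Flat.rTensor_preserves_injective_linearMap i hi
  have h6 : b = (f.lTensor K) a' := sub_eq_zero.mp ((injective_iff_map_eq_zero _).mp hinjN _ h5)
  rw [h6, ← LinearMap.comp_apply, ← LinearMap.lTensor_comp, hfg.linearMap_comp_eq_zero,
    LinearMap.lTensor_zero, LinearMap.zero_apply]

end Literature.RingTheory.Flat
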